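import Summits.ValiantsHypothesis.ValiantsHypothesis.Theorems.LacunarySymmetroidMatrixDescartesPivotResolventRolle
import Summits.ValiantsHypothesis.ValiantsHypothesis.Theorems.LacunarySymmetroidMatrixDescartesCensusSecularRolle

/-!
# `MatrixDescartes` census — rank-one `(2,K)₁`: THE ROOT COUNT BEHIND THE CRITICAL-DIRECTION LAWS
# (`Z₊(det F) ≤ 1 + C_L + C_R`: every per-side law for the critical directions of the window profile is a law for `Z₊`)

HONEST FRAMING.  Object-search cell `pub-symmetroid`, seat `val-sym-mdr-p1` (generation 25); helper file `--supports` the crux item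
stmt-ValiantsHypothesis-18050 (`Theses.LacunarySymmetroid.MatrixDescartes`, OPEN, on HOLD) with NO closure claim.  This file is the
PIPELINE from the lineage's analytic laws (`…CriticalWindows`, `…CriticalWindowsLone*`: statements about the critical points `(x,T)` of the
two-variable window profile `𝔅(x,T) = ∑ₖ wₖx^{dₖ}(T − tₖ)²/(T x^e)`) to the census currency `Z₊` = number of distinct positive zeros of
`det F`, `F(x) = x^e [[0,1],[1,0]] + ∑ₖ wₖ x^{dₖ} (1,tₖ)(1,tₖ)ᵀ` (hyperbolic normal form of the `2 × 2` index-one pivot pencil with rank-one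
letters; `det F(x) = A C − (U + x^e)²`, `A = ∑ Wₖ`, `U = ∑ Wₖtₖ`, `C = ∑ Wₖtₖ²`, `Wₖ = wₖx^{dₖ}`).  A COUNTING INSTRUMENT for one sub-row
(`m = 2`, one letter `p` with `dₚ < e`, the others with `dₘ > e`); nothing here bears on `MatrixDescartes` in its window, on
`DoorA26` / `DoorA34`, registers / credences, or `VP ≠ VNP`; the rank-one register is unchanged.

THE MECHANISM (seat memos LONE-LETTER.md §6 «line picture», NULL-DIRECTION.md; now kernel).
* `det F(x) = 0 ⟺ Φ(x) = 1` with the GAP PROFILE `Φ(x) = (√(A C) − U)/x^e` (`√(AC) + U + x^e > 0`), §3.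
* `Φ` is differentiable on `(0,∞)` with `Φ′(x) = (∑ₖ (dₖ − e)·Wₖ·(T̂ − tₖ)²)/(2T̂·x^{e+1})`, where `T̂ = T̂(x) > 0` is THE OPTIMAL DIRECTION,
  `A T̂² = C` (§3 `hasDerivAt_gapProfile`; the identity `x(√(AC) − U)′ = ∑ dₖWₖ(T̂ − tₖ)²/(2T̂)`, i.e. `(log(√(AC) − U))′ = E_δ[d]` for the
  window measure `δₖ ∝ Wₖ(T̂ − tₖ)²`).  Hence `Φ′(c) = 0` EXACTLY when `(c, T̂(c))` is a critical point of the window profile: the pair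
  satisfies BOTH displayed critical equations `∑ Wₖ(T² − tₖ²) = 0`, `∑ (dₖ − e)Wₖ(T − tₖ)² = 0` of `…CriticalWindows` §4.
* ROLLE (`…PivotResolventRolle.card_posRoots_le_card_add_one`): `Z₊ ≤ 1 + #{c > 0 : Φ′(c) = 0}`.
* SIDES: a critical direction is never the pivot letter's (`T̂(c) ≠ tₚ`, §2 `ne_pivot_of_critical`), and for a given direction `T` the second
  equation has at most ONE positive solution `x` (§2 `critical_x_unique`: it is the Euler derivative of a one-signed fewnomial — the
  elementary one-sign-change Descartes count of `…PivotRankOneCurvature`), so DISTINCT critical points have DISTINCT directions.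
MAIN THEOREMS (this file = §1–§4; the companion `…CriticalWindowsRootCountLone` = §5–§6 plugs in the lone-letter law and the census currency).
* §1 `card_posRoots_le_of_sideBudgets` — ABSTRACT PIPELINE: if the positive roots of `f` are the positive zeros of a differentiable `φ`, a
  «direction map» `τ` never takes the value `tₚ` at a critical point, and every finite set of critical points with `τ < tₚ` (resp. `τ > tₚ`)
  has at most `C_L` (resp. `C_R`) elements, then `Z₊(f) ≤ C_L + C_R + 1` (the critical set is then finite; Rolle).
* §2 `ne_pivot_of_critical`, `critical_x_unique` — the two structural facts above, in the uniform `Finset` currency of `…CriticalWindowsLone*`.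
* §3 `gapProfile_eq_zero_iff`, **`hasDerivAt_gapProfile`** — zeros and derivative of the gap profile.
* §4 **`rankOne_card_posRoots_le_of_sideBudgets`** — THE PENCIL FORM: for positive weights and positions, `dₚ < e < dₘ` (`m ≠ p`), not all
  letters parallel, and any polynomial `f` whose positive roots are the positive zeros of `A C − (U + x^e)²`: if every finite set of scales
  carrying a LEFT critical point (`0 < T < tₚ`) of the window profile has `≤ C_L` elements and every finite set carrying a RIGHT critical point
  (`tₚ < T`) has `≤ C_R`, then **`Z₊(f) ≤ C_L + C_R + 1`**.  Critical points are taken in the currency of `…CriticalWindowsLone*`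
  (`βₘ = dₘ − e`, `λ = 1`).
READING.  With `C` critical directions in all, `Z₊ ≤ C + 1`; the per-side conjecture «`≤ 2` critical directions per letter beyond the pivot
letter on each side» would give `Z₊ ≤ 2K − 1` on the whole `1|K−1` rank-one row, and is now needed only in the analytic currency.

[folklore] Rolle's theorem (through the tree's `card_posRoots_le_card_add_one`), one-variable derivatives (`HasDerivAt.sqrt/.div`,
`…CensusSecularRolle.mul_natCast_mul_pow_pred`), the one-sign-change Descartes count in elementary form; tree theorems named above.
No definitions, no named facts.
-/

-- `Summit.ValiantsHypothesis.ValiantsHypothesis.…` repeats a component by the D-0017 layout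
-- (single-conjunct summit), which the `dupNamespace` linter flags; the name is mandated.
set_option linter.dupNamespace false

namespace Summit.ValiantsHypothesis.ValiantsHypothesis.Theorems.LacunarySymmetroidMatrixDescartes.Pivot.CriticalWindows.RootCount

open Polynomial Finset Set
open scoped BigOperators
open Summit.ValiantsHypothesis.ValiantsHypothesis.Theorems.LacunarySymmetroidMatrixDescartes.Pivot.Resolvent
  (card_posRoots_le_card_add_one)
open Summit.ValiantsHypothesis.ValiantsHypothesis.Theorems.LacunarySymmetroidMatrixDescartes.SecularRolle (mul_natCast_mul_pow_pred)

/-! ## 1. The abstract pipeline: side budgets for the critical points of a profile bound the positive roots -/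

/-- **ABSTRACT PIPELINE.**  Let the positive roots of `f` be the positive zeros of `φ`, differentiable on `(0,∞)` with derivative `φ′`, and
let `τ` be any real function (the «direction» of a point).  If no positive critical point `c` (`φ′(c) = 0`) has `τ(c) = tₚ`, every finite
set of positive critical points with `τ < tₚ` has at most `C_L` elements and every finite set with `tₚ < τ` at most `C_R`, then `f` has at
most `C_L + C_R + 1` distinct positive roots.  (The two budgets force the critical set to be finite; then Rolle.) [folklore] -/
theorem card_posRoots_le_of_sideBudgets (f : ℝ[X]) (φ φ' τ : ℝ → ℝ) (tp : ℝ) (CL CR : ℕ)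
    (hφ : ∀ x, 0 < x → (φ x = 0 ↔ f.IsRoot x)) (hder : ∀ x, 0 < x → HasDerivAt φ (φ' x) x)
    (hne : ∀ c, 0 < c → φ' c = 0 → τ c ≠ tp)
    (hL : ∀ S : Finset ℝ, (∀ c ∈ S, 0 < c ∧ φ' c = 0 ∧ τ c < tp) → S.card ≤ CL)
    (hR : ∀ S : Finset ℝ, (∀ c ∈ S, 0 < c ∧ φ' c = 0 ∧ tp < τ c) → S.card ≤ CR) :
    (f.roots.toFinset.filter (fun t => 0 < t)).card ≤ CL + CR + 1 := by
  classical
  set critL : Set ℝ := {c | 0 < c ∧ φ' c = 0 ∧ τ c < tp} with hcritL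
  set critR : Set ℝ := {c | 0 < c ∧ φ' c = 0 ∧ tp < τ c} with hcritR
  have hfinL : critL.Finite := by
    by_contra hinf
    obtain ⟨S, hS, hcard⟩ := Set.Infinite.exists_subset_card_eq hinf (CL + 1)
    have := hL S fun c hc => hS hc
    omega
  have hfinR : critR.Finite := by
    by_contra hinf
    obtain ⟨S, hS, hcard⟩ := Set.Infinite.exists_subset_card_eq hinf (CR + 1)
    have := hR S fun c hc => hS hc
    omega
  have hcardL : hfinL.toFinset.card ≤ CL := hL _ fun c hc => by simpa [hcritL] using hc
  have hcardR : hfinR.toFinset.card ≤ CR := hR _ fun c hc => by simpa [hcritR] using hc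
  have hT : ∀ c, 0 < c → φ' c = 0 → c ∈ hfinL.toFinset ∪ hfinR.toFinset := by
    intro c hc h0
    rcases lt_or_gt_of_ne (hne c hc h0) with h | h
    · exact Finset.mem_union_left _ (by simpa [hcritL] using And.intro hc (And.intro h0 h))
    · exact Finset.mem_union_right _ (by simpa [hcritR] using And.intro hc (And.intro h0 h))
  have h := card_posRoots_le_card_add_one f φ φ' hφ hder _ hT
  have hu := Finset.card_union_le hfinL.toFinset hfinR.toFinset
  omega

/-! ## 2. Two facts about critical points of the window profile: never the pivot direction; one `x` per direction -/

/-- **NEVER THE PIVOT DIRECTION.**  If `T = tₚ` satisfies the second critical equation `∑ₘ (dₘ − e)Wₘ(T − tₘ)² = 0` (positive weights, `dₚ < e`,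
`dₘ > e` off the pivot letter), then every letter is parallel to the pivot letter (`tₘ = tₚ`).  Uniform-`Finset` form of
`…CriticalWindows.eq_pivot_of_critical_pivot`. [folklore] -/
theorem ne_pivot_of_critical {ι : Type*} (s : Finset ι) (w t : ι → ℝ) (d : ι → ℕ) (e : ℕ) (p : ι)
    (hw : ∀ m ∈ s, 0 < w m) (hdm : ∀ m ∈ s, m ≠ p → e < d m) {x T : ℝ} (hx : 0 < x)
    (h2 : ∑ m ∈ s, ((d m : ℝ) - e) * (w m * x ^ d m) * (T - t m) ^ 2 = 0) (hT : T = t p) :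
    ∀ m ∈ s, t m = t p := by
  subst hT
  have hnn : ∀ m ∈ s, 0 ≤ ((d m : ℝ) - e) * (w m * x ^ d m) * (t p - t m) ^ 2 := by
    intro m hm
    by_cases hmp : m = p
    · subst hmp; simp
    · have h1 : (0 : ℝ) ≤ (d m : ℝ) - e := by
        have : (e : ℝ) < (d m : ℝ) := by exact_mod_cast hdm m hm hmp
        linarith
      exact mul_nonneg (mul_nonneg h1 (mul_pos (hw m hm) (pow_pos hx _)).le) (sq_nonneg _)
  have hall := (Finset.sum_eq_zero_iff_of_nonneg hnn).1 h2
  intro m hm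
  by_cases hmp : m = p
  · rw [hmp]
  · have h := hall m hm
    have h1 : (0 : ℝ) < (d m : ℝ) - e := by
      have : (e : ℝ) < (d m : ℝ) := by exact_mod_cast hdm m hm hmp
      linarith
    rcases mul_eq_zero.1 h with h' | h'
    · rcases mul_eq_zero.1 h' with h'' | h''
      · exact absurd h'' h1.ne'
      · exact absurd h'' (mul_pos (hw m hm) (pow_pos hx _)).ne'
    · have h3 : t p - t m = 0 := (pow_eq_zero_iff two_ne_zero).1 h'
      linarith

/-- **ONE SCALE PER DIRECTION.**  For a fixed direction `T`, the second critical equation `∑ₘ (dₘ − e)·wₘ(T − tₘ)²·x^{dₘ} = 0` is the Euler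
derivative (weight `e`) of a fewnomial with NON-NEGATIVE coefficients, so two distinct positive solutions `x₁ ≠ x₂` force every coefficient
`wₘ(T − tₘ)²` with `dₘ ≠ e` to vanish (the one-sign-change Descartes count in the elementary form of
`…PivotRankOneCurvature.card_posRoots_le_one_of_eulerForm`): with `dₘ ≠ e` for all letters, all letters are then parallel to the direction.
Hence for a non-parallel configuration the critical points of the window profile have pairwise DISTINCT directions. [folklore] -/
theorem critical_x_unique {ι : Type*} (s : Finset ι) (w t : ι → ℝ) (d : ι → ℕ) (e : ℕ) (p : ι) (hp : p ∈ s)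
    (hw : ∀ m ∈ s, 0 < w m) (hde : ∀ m ∈ s, d m ≠ e) (hnp : ∃ m ∈ s, t m ≠ t p) {x₁ x₂ T : ℝ} (hx₁ : 0 < x₁) (hx₂ : 0 < x₂)
    (h₁ : ∑ m ∈ s, ((d m : ℝ) - e) * (w m * x₁ ^ d m) * (T - t m) ^ 2 = 0)
    (h₂ : ∑ m ∈ s, ((d m : ℝ) - e) * (w m * x₂ ^ d m) * (T - t m) ^ 2 = 0) : x₁ = x₂ := by
  classical
  -- two distinct positive zeros of an Euler form force every term to be trivial
  have key : ∀ x y : ℝ, 0 < x → x < y →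
      (∑ m ∈ s, ((d m : ℝ) - e) * (w m * x ^ d m) * (T - t m) ^ 2 = 0) →
      (∑ m ∈ s, ((d m : ℝ) - e) * (w m * y ^ d m) * (T - t m) ^ 2 = 0) → ∀ m ∈ s, (T - t m) ^ 2 = 0 := by
    intro x y hx hxy hpx hpy i hi
    set r : ℝ := y / x with hr
    have hr1 : 1 < r := (one_lt_div hx).2 hxy
    have hr0 : 0 < r := by linarith
    have hyx : y = x * r := by rw [hr]; field_simp
    have hpy' : ∑ j ∈ s, ((d j : ℝ) - e) * (w j * x ^ d j) * (T - t j) ^ 2 * r ^ (d j) = 0 := by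
      rw [← hpy, hyx]
      refine Finset.sum_congr rfl fun j _ => ?_
      rw [mul_pow]; ring
    have hpx' : ∑ j ∈ s, ((d j : ℝ) - e) * (w j * x ^ d j) * (T - t j) ^ 2 * r ^ e = 0 := by
      rw [← Finset.sum_mul, hpx, zero_mul]
    have hsum : ∑ j ∈ s, ((d j : ℝ) - e) * (w j * x ^ d j) * (T - t j) ^ 2 * (r ^ (d j) - r ^ e) = 0 := by
      have : ∑ j ∈ s, ((d j : ℝ) - e) * (w j * x ^ d j) * (T - t j) ^ 2 * (r ^ (d j) - r ^ e)
          = ∑ j ∈ s, ((d j : ℝ) - e) * (w j * x ^ d j) * (T - t j) ^ 2 * r ^ (d j)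
            - ∑ j ∈ s, ((d j : ℝ) - e) * (w j * x ^ d j) * (T - t j) ^ 2 * r ^ e := by
        rw [← Finset.sum_sub_distrib]
        exact Finset.sum_congr rfl fun j _ => by ring
      rw [this, hpy', hpx', sub_zero]
    have hnonneg : ∀ j ∈ s, 0 ≤ ((d j : ℝ) - e) * (w j * x ^ d j) * (T - t j) ^ 2 * (r ^ (d j) - r ^ e) := by
      intro j hj
      have hcx : 0 ≤ (w j * x ^ d j) * (T - t j) ^ 2 := mul_nonneg (mul_pos (hw j hj) (pow_pos hx _)).le (sq_nonneg _)
      have hmono : 0 ≤ ((d j : ℝ) - e) * (r ^ (d j) - r ^ e) := by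
        rcases le_or_gt e (d j) with h | h
        · have h1 : (0 : ℝ) ≤ (d j : ℝ) - e := by
            have : (e : ℝ) ≤ (d j : ℝ) := by exact_mod_cast h
            linarith
          have h2 : (0 : ℝ) ≤ r ^ (d j) - r ^ e := by
            have := pow_le_pow_right₀ hr1.le h
            linarith
          exact mul_nonneg h1 h2
        · have h1 : (d j : ℝ) - e ≤ 0 := by
            have : (d j : ℝ) ≤ (e : ℝ) := by exact_mod_cast h.le
            linarith
          have h2 : r ^ (d j) - r ^ e ≤ 0 := by
            have := pow_le_pow_right₀ hr1.le h.le
            linarith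
          exact mul_nonneg_of_nonpos_of_nonpos h1 h2
      have : ((d j : ℝ) - e) * (w j * x ^ d j) * (T - t j) ^ 2 * (r ^ (d j) - r ^ e)
          = ((w j * x ^ d j) * (T - t j) ^ 2) * (((d j : ℝ) - e) * (r ^ (d j) - r ^ e)) := by ring
      rw [this]
      exact mul_nonneg hcx hmono
    have hterm := (Finset.sum_eq_zero_iff_of_nonneg hnonneg).1 hsum i hi
    have hna : ((d i : ℝ) - e) ≠ 0 := by
      intro h
      apply hde i hi
      have : (d i : ℝ) = (e : ℝ) := by linarith
      exact_mod_cast this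
    have hrpow : r ^ (d i) - r ^ e ≠ 0 := by
      intro h
      exact hde i hi (pow_right_injective₀ hr0 hr1.ne' (sub_eq_zero.1 h))
    have hwx : w i * x ^ d i ≠ 0 := (mul_pos (hw i hi) (pow_pos hx _)).ne'
    rcases mul_eq_zero.1 hterm with h | h
    · rcases mul_eq_zero.1 h with h' | h'
      · rcases mul_eq_zero.1 h' with h'' | h''
        · exact absurd h'' hna
        · exact absurd h'' hwx
      · exact h'
    · exact absurd h hrpow
  by_contra hne
  have hall : ∀ m ∈ s, (T - t m) ^ 2 = 0 := by
    rcases lt_or_gt_of_ne hne with h | h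
    · exact key x₁ x₂ hx₁ h h₁ h₂
    · exact key x₂ x₁ hx₂ h h₂ h₁
  obtain ⟨m, hm, hmt⟩ := hnp
  have h1 : T - t m = 0 := (pow_eq_zero_iff two_ne_zero).1 (hall m hm)
  have h2 : T - t p = 0 := (pow_eq_zero_iff two_ne_zero).1 (hall p hp)
  exact hmt (by linarith)

/-! ## 3. The gap profile `Φ(x) = (√(AC) − U)/x^e − 1`: zeros and derivative -/

/-- Euler derivative of a fewnomial with natural exponents: `∑ cₖ x^{nₖ}` has derivative `∑ cₖ·nₖx^{nₖ−1}` at `x ≠ 0`, and `x` times it is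
`∑ nₖcₖx^{nₖ}`. [folklore] -/
theorem hasDerivAt_fewnomial {ι : Type*} (s : Finset ι) (c : ι → ℝ) (n : ι → ℕ) (x : ℝ) :
    HasDerivAt (fun y => ∑ k ∈ s, c k * y ^ n k) (∑ k ∈ s, c k * ((n k : ℝ) * x ^ (n k - 1))) x :=
  HasDerivAt.fun_sum (u := s) (A := fun k y => c k * y ^ n k) (A' := fun k => c k * ((n k : ℝ) * x ^ (n k - 1)))
    fun k _ => (hasDerivAt_pow (n k) x).const_mul (c k)

/-- `x · ∑ cₖ·nₖx^{nₖ−1} = ∑ nₖ cₖ x^{nₖ}` (natural exponents; the `nₖ = 0` terms vanish on both sides; termwise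
`…CensusSecularRolle.mul_natCast_mul_pow_pred`). [folklore] -/
theorem euler_fewnomial {ι : Type*} (s : Finset ι) (c : ι → ℝ) (n : ι → ℕ) (x : ℝ) :
    x * ∑ k ∈ s, c k * ((n k : ℝ) * x ^ (n k - 1)) = ∑ k ∈ s, (n k : ℝ) * c k * x ^ n k := by
  rw [Finset.mul_sum]
  refine Finset.sum_congr rfl fun k _ => ?_
  have h := mul_natCast_mul_pow_pred x (n k)
  calc x * (c k * ((n k : ℝ) * x ^ (n k - 1))) = c k * (x * ((n k : ℝ) * x ^ (n k - 1))) := by ring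
    _ = c k * ((n k : ℝ) * x ^ n k) := by rw [h]
    _ = (n k : ℝ) * c k * x ^ n k := by ring

/-- Positivity of the three moment fewnomials `A = ∑ wₖx^{dₖ}`, `U = ∑ wₖtₖx^{dₖ}`, `C = ∑ wₖtₖ²x^{dₖ}` for positive data. [folklore] -/
theorem moments_pos {ι : Type*} (s : Finset ι) (hs : s.Nonempty) (w t : ι → ℝ) (d : ι → ℕ) (hw : ∀ m ∈ s, 0 < w m)
    (ht : ∀ m ∈ s, 0 < t m) {x : ℝ} (hx : 0 < x) :
    0 < ∑ k ∈ s, w k * x ^ d k ∧ 0 < ∑ k ∈ s, w k * t k * x ^ d k ∧ 0 < ∑ k ∈ s, w k * t k ^ 2 * x ^ d k :=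
  ⟨Finset.sum_pos (fun k hk => mul_pos (hw k hk) (pow_pos hx _)) hs,
    Finset.sum_pos (fun k hk => mul_pos (mul_pos (hw k hk) (ht k hk)) (pow_pos hx _)) hs,
    Finset.sum_pos (fun k hk => mul_pos (mul_pos (hw k hk) (pow_pos (ht k hk) 2)) (pow_pos hx _)) hs⟩

/-- **ZEROS OF THE GAP PROFILE ARE THE ROOTS OF `det F`.**  For `A, C ≥ 0` with `U + E ≥ 0` and `E > 0`:
`(√(AC) − U)/E − 1 = 0 ⟺ A C − (U + E)² = 0`. [folklore] -/
theorem gapProfile_eq_zero_iff (A U C E : ℝ) (hAC : 0 ≤ A * C) (hUE : 0 ≤ U + E) (hE : 0 < E) :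
    (Real.sqrt (A * C) - U) / E - 1 = 0 ↔ A * C - (U + E) ^ 2 = 0 := by
  rw [sub_eq_zero, div_eq_one_iff_eq hE.ne', sub_eq_iff_eq_add]
  constructor
  · intro h
    have := Real.sq_sqrt hAC
    rw [h] at this
    linarith [this]
  · intro h
    have h' : A * C = (U + E) ^ 2 := by linarith
    rw [h', Real.sqrt_sq hUE]
    ring

/-- Expansion of the second critical equation at a direction `τ` in the moment fewnomials: with `P₀ = ∑ dₖWₖ`, `P₁ = ∑ dₖWₖtₖ`,
`P₂ = ∑ dₖWₖtₖ²`: `∑ (dₖ − e)Wₖ(τ − tₖ)² = τ²(P₀ − eA) − 2τ(P₁ − eU) + (P₂ − eC)`. [folklore] -/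
theorem critical_sum_expand {ι : Type*} (s : Finset ι) (w t : ι → ℝ) (d : ι → ℕ) (e : ℕ) (x τ : ℝ) :
    ∑ k ∈ s, ((d k : ℝ) - e) * (w k * x ^ d k) * (τ - t k) ^ 2
      = τ ^ 2 * ((∑ k ∈ s, (d k : ℝ) * w k * x ^ d k) - e * ∑ k ∈ s, w k * x ^ d k)
        - 2 * τ * ((∑ k ∈ s, (d k : ℝ) * (w k * t k) * x ^ d k) - e * ∑ k ∈ s, w k * t k * x ^ d k)
        + ((∑ k ∈ s, (d k : ℝ) * (w k * t k ^ 2) * x ^ d k) - e * ∑ k ∈ s, w k * t k ^ 2 * x ^ d k) := by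
  have h1 : ∑ k ∈ s, ((d k : ℝ) - e) * (w k * x ^ d k) * (τ - t k) ^ 2
      = τ ^ 2 * ∑ k ∈ s, (d k : ℝ) * w k * x ^ d k - τ ^ 2 * e * ∑ k ∈ s, w k * x ^ d k
        - 2 * τ * ∑ k ∈ s, (d k : ℝ) * (w k * t k) * x ^ d k + 2 * τ * e * ∑ k ∈ s, w k * t k * x ^ d k
        + ∑ k ∈ s, (d k : ℝ) * (w k * t k ^ 2) * x ^ d k - e * ∑ k ∈ s, w k * t k ^ 2 * x ^ d k := by
    simp only [Finset.mul_sum, ← Finset.sum_sub_distrib, ← Finset.sum_add_distrib]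
    exact Finset.sum_congr rfl fun k _ => by ring
  rw [h1]; ring

/-- **DERIVATIVE OF THE GAP PROFILE.**  For positive data and `x > 0`, with `T̂ > 0` the optimal direction (`A T̂² = C`):
`Φ(y) = (√(A(y)C(y)) − U(y))/y^e − 1` has derivative `(∑ₖ (dₖ − e)·wₖx^{dₖ}·(T̂ − tₖ)²)/(2T̂·x^{e+1})` at `x`. [folklore] -/
theorem hasDerivAt_gapProfile {ι : Type*} (s : Finset ι) (hs : s.Nonempty) (w t : ι → ℝ) (d : ι → ℕ) (e : ℕ)
    (hw : ∀ m ∈ s, 0 < w m) (ht : ∀ m ∈ s, 0 < t m) {x τ : ℝ} (hx : 0 < x) (hτ : 0 < τ)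
    (hτC : (∑ k ∈ s, w k * x ^ d k) * τ ^ 2 = ∑ k ∈ s, w k * t k ^ 2 * x ^ d k) :
    HasDerivAt (fun y => (Real.sqrt ((∑ k ∈ s, w k * y ^ d k) * (∑ k ∈ s, w k * t k ^ 2 * y ^ d k))
        - ∑ k ∈ s, w k * t k * y ^ d k) / y ^ e - 1)
      ((∑ k ∈ s, ((d k : ℝ) - e) * (w k * x ^ d k) * (τ - t k) ^ 2) / (2 * τ * x ^ (e + 1))) x := by
  obtain ⟨hA, hU, hC⟩ := moments_pos s hs w t d hw ht hx
  have hdA : HasDerivAt (fun y => ∑ k ∈ s, w k * y ^ d k) (∑ k ∈ s, w k * ((d k : ℝ) * x ^ (d k - 1))) x :=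
    hasDerivAt_fewnomial s w d x
  have hdU : HasDerivAt (fun y => ∑ k ∈ s, w k * t k * y ^ d k) (∑ k ∈ s, w k * t k * ((d k : ℝ) * x ^ (d k - 1))) x :=
    hasDerivAt_fewnomial s (fun k => w k * t k) d x
  have hdC : HasDerivAt (fun y => ∑ k ∈ s, w k * t k ^ 2 * y ^ d k)
      (∑ k ∈ s, w k * t k ^ 2 * ((d k : ℝ) * x ^ (d k - 1))) x :=
    hasDerivAt_fewnomial s (fun k => w k * t k ^ 2) d x
  have hAC : (∑ k ∈ s, w k * x ^ d k) * (∑ k ∈ s, w k * t k ^ 2 * x ^ d k) ≠ 0 := (mul_pos hA hC).ne'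
  have hxe : x ^ e ≠ 0 := (pow_pos hx e).ne'
  have hdiv := (((hdA.fun_mul hdC).sqrt hAC).fun_sub hdU).fun_div (hasDerivAt_pow e x) hxe |>.sub_const 1
  refine hdiv.congr_deriv ?_
  -- identify the derivative value: √(AC) = A·T̂, Euler derivatives, expansion of the critical sum
  have hSτ : Real.sqrt ((∑ k ∈ s, w k * x ^ d k) * (∑ k ∈ s, w k * t k ^ 2 * x ^ d k)) = (∑ k ∈ s, w k * x ^ d k) * τ := by
    rw [← hτC]
    have : (∑ k ∈ s, w k * x ^ d k) * ((∑ k ∈ s, w k * x ^ d k) * τ ^ 2) = ((∑ k ∈ s, w k * x ^ d k) * τ) ^ 2 := by ring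
    rw [this, Real.sqrt_sq (mul_pos hA hτ).le]
  have hP₀ : (∑ k ∈ s, w k * ((d k : ℝ) * x ^ (d k - 1))) = (∑ k ∈ s, (d k : ℝ) * w k * x ^ d k) / x := by
    rw [eq_div_iff hx.ne', mul_comm]; exact euler_fewnomial s w d x
  have hP₁ : (∑ k ∈ s, w k * t k * ((d k : ℝ) * x ^ (d k - 1))) = (∑ k ∈ s, (d k : ℝ) * (w k * t k) * x ^ d k) / x := by
    rw [eq_div_iff hx.ne', mul_comm]; exact euler_fewnomial s (fun k => w k * t k) d x
  have hP₂ : (∑ k ∈ s, w k * t k ^ 2 * ((d k : ℝ) * x ^ (d k - 1)))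
      = (∑ k ∈ s, (d k : ℝ) * (w k * t k ^ 2) * x ^ d k) / x := by
    rw [eq_div_iff hx.ne', mul_comm]; exact euler_fewnomial s (fun k => w k * t k ^ 2) d x
  have hxe' : (e : ℝ) * x ^ (e - 1) = (e : ℝ) * x ^ e / x := by
    rw [eq_div_iff hx.ne', mul_comm]; exact mul_natCast_mul_pow_pred x e
  rw [hSτ, hP₀, hP₁, hP₂, hxe', critical_sum_expand, ← hτC, pow_succ]
  field_simp
  ring

/-! ## 4. The pencil form of the pipeline -/

/-- **THE ROOT COUNT BEHIND THE CRITICAL-DIRECTION LAWS (pencil form).**  Rank-one hyperbolic pencil data on a `Finset`: positive weights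
`wₘ` and positions `tₘ`, natural exponents `dₘ`, a pivot exponent `e` with `dₚ < e` for ONE letter `p` and `e < dₘ` for the others, not all
letters parallel; `f` any real polynomial whose positive roots are the positive zeros of `A C − (U + x^e)²` (`= det F`).  If every finite set
of positive scales `x` carrying a critical point `(x,T)` of the window profile with `0 < T < tₚ` (LEFT) has at most `C_L` elements, and every
finite set carrying one with `tₚ < T` (RIGHT) at most `C_R`, then **`Z₊(f) ≤ C_L + C_R + 1`**.  The critical equations are those of
`…CriticalWindowsLone*` with rates `βₘ = dₘ − e` (`λ = 1`). [this file] -/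
theorem rankOne_card_posRoots_le_of_sideBudgets {ι : Type*} (s : Finset ι) (w t : ι → ℝ) (d : ι → ℕ) (e : ℕ) (p : ι)
    (hp : p ∈ s) (hw : ∀ m ∈ s, 0 < w m) (ht : ∀ m ∈ s, 0 < t m) (hdp : d p < e) (hdm : ∀ m ∈ s, m ≠ p → e < d m)
    (hnp : ∃ m ∈ s, t m ≠ t p) (f : ℝ[X])
    (hf : ∀ x, 0 < x → (f.IsRoot x ↔ (∑ k ∈ s, w k * x ^ d k) * (∑ k ∈ s, w k * t k ^ 2 * x ^ d k)
      - ((∑ k ∈ s, w k * t k * x ^ d k) + x ^ e) ^ 2 = 0))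
    (CL CR : ℕ)
    (hL : ∀ S : Finset ℝ, (∀ x ∈ S, 0 < x ∧ ∃ T, 0 < T ∧ T < t p ∧
        (∑ m ∈ s, w m * x ^ d m * (T ^ 2 - t m ^ 2) = 0) ∧
        (∑ m ∈ s, ((d m : ℝ) - e) * (w m * x ^ d m) * (T - t m) ^ 2 = 0)) → S.card ≤ CL)
    (hR : ∀ S : Finset ℝ, (∀ x ∈ S, 0 < x ∧ ∃ T, t p < T ∧
        (∑ m ∈ s, w m * x ^ d m * (T ^ 2 - t m ^ 2) = 0) ∧
        (∑ m ∈ s, ((d m : ℝ) - e) * (w m * x ^ d m) * (T - t m) ^ 2 = 0)) → S.card ≤ CR) :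
    (f.roots.toFinset.filter (fun t => 0 < t)).card ≤ CL + CR + 1 := by
  classical
  have hs : s.Nonempty := ⟨p, hp⟩
  -- the optimal direction T̂(x) = √(C/A)
  set τ : ℝ → ℝ := fun x => Real.sqrt ((∑ k ∈ s, w k * t k ^ 2 * x ^ d k) / (∑ k ∈ s, w k * x ^ d k)) with hτdef
  have hτpos : ∀ x, 0 < x → 0 < τ x := by
    intro x hx
    obtain ⟨hA, -, hC⟩ := moments_pos s hs w t d hw ht hx
    exact Real.sqrt_pos.2 (div_pos hC hA)
  have hτC : ∀ x, 0 < x → (∑ k ∈ s, w k * x ^ d k) * τ x ^ 2 = ∑ k ∈ s, w k * t k ^ 2 * x ^ d k := by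
    intro x hx
    obtain ⟨hA, -, hC⟩ := moments_pos s hs w t d hw ht hx
    rw [hτdef, Real.sq_sqrt (div_pos hC hA).le]
    field_simp
  -- first critical equation holds identically at T̂
  have hE1 : ∀ x, 0 < x → ∑ m ∈ s, w m * x ^ d m * (τ x ^ 2 - t m ^ 2) = 0 := by
    intro x hx
    have h := hτC x hx
    have : ∑ m ∈ s, w m * x ^ d m * (τ x ^ 2 - t m ^ 2)
        = (∑ k ∈ s, w k * x ^ d k) * τ x ^ 2 - ∑ k ∈ s, w k * t k ^ 2 * x ^ d k := by
      rw [Finset.sum_mul, ← Finset.sum_sub_distrib]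
      exact Finset.sum_congr rfl fun k _ => by ring
    rw [this, h, sub_self]
  set φ : ℝ → ℝ := fun y => (Real.sqrt ((∑ k ∈ s, w k * y ^ d k) * (∑ k ∈ s, w k * t k ^ 2 * y ^ d k))
      - ∑ k ∈ s, w k * t k * y ^ d k) / y ^ e - 1 with hφdef
  set φ' : ℝ → ℝ := fun x => (∑ k ∈ s, ((d k : ℝ) - e) * (w k * x ^ d k) * (τ x - t k) ^ 2) / (2 * τ x * x ^ (e + 1))
    with hφ'def
  have hφ : ∀ x, 0 < x → (φ x = 0 ↔ f.IsRoot x) := by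
    intro x hx
    obtain ⟨hA, hU, hC⟩ := moments_pos s hs w t d hw ht hx
    rw [hf x hx, hφdef]
    exact gapProfile_eq_zero_iff _ _ _ _ (mul_pos hA hC).le (add_pos hU (pow_pos hx e)).le (pow_pos hx e)
  have hder : ∀ x, 0 < x → HasDerivAt φ (φ' x) x := fun x hx =>
    hasDerivAt_gapProfile s hs w t d e hw ht hx (hτpos x hx) (hτC x hx)
  -- φ′(c) = 0 ⟺ the second critical equation at (c, T̂(c))
  have hE2 : ∀ c, 0 < c → φ' c = 0 → ∑ m ∈ s, ((d m : ℝ) - e) * (w m * c ^ d m) * (τ c - t m) ^ 2 = 0 := by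
    intro c hc h0
    rw [hφ'def, div_eq_zero_iff] at h0
    rcases h0 with h0 | h0
    · exact h0
    · exact absurd h0 (mul_pos (mul_pos two_pos (hτpos c hc)) (pow_pos hc _)).ne'
  have hde : ∀ m ∈ s, d m ≠ e := by
    intro m hm
    by_cases hmp : m = p
    · rw [hmp]; exact hdp.ne
    · exact (hdm m hm hmp).ne'
  refine card_posRoots_le_of_sideBudgets f φ φ' τ (t p) CL CR hφ hder ?_ ?_ ?_
  · intro c hc h0 hτp
    obtain ⟨m, hm, hmt⟩ := hnp
    exact hmt (ne_pivot_of_critical s w t d e p hw hdm hc (hE2 c hc h0) hτp m hm)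
  · intro S hS
    exact hL S fun x hx => ⟨(hS x hx).1, τ x, hτpos x (hS x hx).1, (hS x hx).2.2, hE1 x (hS x hx).1, hE2 x (hS x hx).1 (hS x hx).2.1⟩
  · intro S hS
    exact hR S fun x hx => ⟨(hS x hx).1, τ x, (hS x hx).2.2, hE1 x (hS x hx).1, hE2 x (hS x hx).1 (hS x hx).2.1⟩

end Summit.ValiantsHypothesis.ValiantsHypothesis.Theorems.LacunarySymmetroidMatrixDescartes.Pivot.CriticalWindows.RootCount
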